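import Summits.CriticalPhenomena.CardyFormulaZ2.Theses.CardyBoundaryCoulombGas
import Literature.Probability.LatticeModels.RowStatePlanar
import Literature.Probability.Percolation.LatticeSymmetry
import Literature.Probability.Percolation.PlanarDuality
import Literature.Probability.Percolation.RSW

/-!
# Two-cluster dictionary, event identity: two distinct spanning clusters = coupling disagreement

Helper file for the stub `stub_twoClusterDictionary` (D3) of the line
`two-cluster-rate-is-stationary-gap` of crux `CardyBoundaryCoulombGas.StripClusterRates`
(stmt-CriticalPhenomena-13878).

Fix a lattice configuration `ω ⊆ E(ℤ²)` and the rectangle `R = [0,m] × [0,n]`. Write `ω⁺ = ω ∪ F`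
where `F` is a set of lattice edges with both endpoints on the column `x = 0` containing all the
vertical edges of the left side of `R` ("wire the left side").

* `d3_union_conn`: an `ω⁺`-open path inside `R` is either an `ω`-open path, or both its endpoints
  are `ω`-joined inside `R` to the left side (cut the path at its first and last `F`-edge).
* `d3_leftSide_conn`: the left side is `ω⁺`-connected inside `R`.
* `d3_twoCluster_iff`: if a connectivity state `X` of the last column encodes `ω`-connectivity inside
  `R` and `Y` encodes `ω⁺`-connectivity (both with `⋆` apart), then the crux's event "two open
  left–right crossings of `R` in distinct open clusters" holds iff `Y ≠ X` — the wired-versus-free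
  DISAGREEMENT of the grand coupling of the `⋆`-chain (cf. the sketch lemma
  `disagreementEvent_eq_twoClusterEvent` of `Cruxes/StripClusterRates/SketchIdeator1.lean`).

Sources: folklore (boundary-condition coupling of planar percolation / random-cluster connectivities);
Levin–Peres–Wilmer, *Markov chains and mixing times* (2009), §5 (grand coupling).
-/

noncomputable section

namespace Summit.CriticalPhenomena.CardyFormulaZ2.Cruxes.StripClusterRates.TwoClusterRateIsStationaryGap

open Filter Topology
open scoped BigOperators Classical
open Literature.Probability.Percolation Literature.Probability.LatticeModels

/-- **Cutting a path at the wired column.** If `F` consists of edges with both endpoints on the column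
`x = 0`, an `(ω ∪ F)`-open path inside the rectangle is an `ω`-open path, unless both of its endpoints
are `ω`-joined inside the rectangle to the left side. -/
theorem d3_union_conn (m n : ℕ) (ω F : Set (Sym2 (Site 2))) (hω : ω ⊆ (zdGraph 2).edgeSet)
    (hFE : F ⊆ (zdGraph 2).edgeSet) (hF0 : ∀ u w : Site 2, s(u, w) ∈ F → u 0 = 0 ∧ w 0 = 0)
    (u v : Site 2) (h : ω ∪ F ∈ openConnIn (rectangle m n : Set (Site 2)) u v) :
    ω ∈ openConnIn (rectangle m n : Set (Site 2)) u v ∨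
      ((∃ x ∈ (leftSide m n : Set (Site 2)), ω ∈ openConnIn (rectangle m n : Set (Site 2)) x u) ∧
        ∃ x ∈ (leftSide m n : Set (Site 2)), ω ∈ openConnIn (rectangle m n : Set (Site 2)) x v) := by
  obtain ⟨P, hPs, hPe⟩ := exists_walk_of_mem_openConnIn (Set.union_subset hω hFE) h
  clear h
  have hleft : ∀ z : Site 2, z ∈ (rectangle m n : Set (Site 2)) → z 0 = 0 →
      z ∈ (leftSide m n : Set (Site 2)) := by
    intro z hz hz0
    simp only [Finset.mem_coe, leftSide, Finset.mem_filter] at hz ⊢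
    exact ⟨hz, hz0⟩
  induction P with
  | nil =>
    exact Or.inl (openConnIn_refl (hPs _ (by simp)))
  | @cons u w v hadj P ih =>
    have huR : u ∈ (rectangle m n : Set (Site 2)) := hPs u (by simp)
    have hwR : w ∈ (rectangle m n : Set (Site 2)) := hPs w (by simp)
    have he : s(u, w) ∈ ω ∪ F := hPe _ (by simp)
    have ih' := ih (fun z hz => hPs z (by simp [hz])) (fun e he' => hPe e (by simp [he']))
    rcases he with heω | heF
    · have huw : ω ∈ openConnIn (rectangle m n : Set (Site 2)) u w :=
        openConnIn_of_adj huR hwR heω hadj.ne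
      rcases ih' with hwv | ⟨⟨x, hx, hxw⟩, hjv⟩
      · exact Or.inl (PlanarDuality.openConnIn_trans huw hwv)
      · refine Or.inr ⟨⟨x, hx, PlanarDuality.openConnIn_trans hxw ?_⟩, hjv⟩
        rwa [openConnIn_comm]
    · obtain ⟨hu0, hw0⟩ := hF0 u w heF
      have huL := hleft u huR hu0
      have hwL := hleft w hwR hw0
      rcases ih' with hwv | ⟨-, hjv⟩
      · exact Or.inr ⟨⟨u, huL, openConnIn_refl huR⟩, ⟨w, hwL, hwv⟩⟩
      · exact Or.inr ⟨⟨u, huL, openConnIn_refl huR⟩, hjv⟩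

/-- **The wired left side is connected.** If `F` contains every vertical edge of the left side of
`[0,m] × [0,n]`, any two sites of the left side are `(ω ∪ F)`-joined inside the rectangle. -/
theorem d3_leftSide_conn (m n : ℕ) (ω F : Set (Sym2 (Site 2)))
    (hFV : ∀ y : ℤ, 0 ≤ y → y + 1 ≤ n → s(![0, y], ![0, y + 1]) ∈ F)
    (x₁ x₂ : Site 2) (hx₁ : x₁ ∈ (leftSide m n : Set (Site 2)))
    (hx₂ : x₂ ∈ (leftSide m n : Set (Site 2))) :
    ω ∪ F ∈ openConnIn (rectangle m n : Set (Site 2)) x₁ x₂ := by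
  have hmem : ∀ k : ℕ, k ≤ n → (![0, (k : ℤ)] : Site 2) ∈ (rectangle m n : Set (Site 2)) := by
    intro k hk
    simp only [Finset.mem_coe, mem_rectangle_iff, Matrix.cons_val_zero, Matrix.cons_val_one,
      Matrix.cons_val_fin_one]
    omega
  have hcol : ∀ k : ℕ, k ≤ n → ω ∪ F ∈ openConnIn (rectangle m n : Set (Site 2)) ![0, 0] ![0, (k : ℤ)] := by
    intro k
    induction k with
    | zero => intro _; exact_mod_cast openConnIn_refl (hmem 0 (Nat.zero_le n))
    | succ k ih =>
      intro hk
      refine PlanarDuality.openConnIn_trans (ih (Nat.le_of_succ_le hk)) ?_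
      refine openConnIn_of_adj (hmem k (Nat.le_of_succ_le hk)) (by exact_mod_cast hmem (k + 1) hk)
        (Or.inr ?_) ?_
      · have := hFV k (by positivity) (by exact_mod_cast hk)
        exact_mod_cast this
      · intro heq
        have := congr_fun heq 1
        simp at this
  have hpt : ∀ x : Site 2, x ∈ (leftSide m n : Set (Site 2)) →
      ∃ k : ℕ, k ≤ n ∧ x = ![0, (k : ℤ)] := by
    intro x hx
    simp only [Finset.mem_coe, leftSide, Finset.mem_filter, mem_rectangle_iff] at hx
    refine ⟨(x 1).toNat, by omega, ?_⟩
    rw [Site.eq_iff_two]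
    simp only [Matrix.cons_val_zero, Matrix.cons_val_one, Matrix.cons_val_fin_one]
    omega
  obtain ⟨k₁, hk₁, rfl⟩ := hpt x₁ hx₁
  obtain ⟨k₂, hk₂, rfl⟩ := hpt x₂ hx₂
  refine PlanarDuality.openConnIn_trans ?_ (hcol k₂ hk₂)
  rw [openConnIn_comm]
  exact hcol k₁ hk₁

/-- **Event identity (pathwise).** Let `X` encode `ω`-connectivity of the last column of
`[0,m] × [0,n]` inside the rectangle and `Y` encode `(ω ∪ F)`-connectivity, `F` wiring the left side
(both with `⋆` apart). Then the crux's event "two open left–right crossings in distinct open clusters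
of the rectangle" holds at `ω` iff the two states DISAGREE. -/
theorem d3_twoCluster_iff : ∀ (m n : ℕ) (ω F : Set (Sym2 (Site 2))), ω ⊆ (zdGraph 2).edgeSet →
    F ⊆ (zdGraph 2).edgeSet → (∀ u w : Site 2, s(u, w) ∈ F → u 0 = 0 ∧ w 0 = 0) →
    (∀ y : ℤ, 0 ≤ y → y + 1 ≤ n → s(![0, y], ![0, y + 1]) ∈ F) →
    ∀ (X Y : PlanarRowState (Finset.Icc (0 : ℤ) n)),
    (∀ a b, X.1.rel (Sum.inl a) (Sum.inl b) ↔
      ω ∈ openConnIn (rectangle m n : Set (Site 2)) ![(m : ℤ), (a : ℤ)] ![(m : ℤ), (b : ℤ)]) →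
    (∀ a, ¬ X.1.JoinedToStar a) →
    (∀ a b, Y.1.rel (Sum.inl a) (Sum.inl b) ↔
      ω ∪ F ∈ openConnIn (rectangle m n : Set (Site 2)) ![(m : ℤ), (a : ℤ)] ![(m : ℤ), (b : ℤ)]) →
    (∀ a, ¬ Y.1.JoinedToStar a) →
    (ω ∈ {ω | ∃ x₁ ∈ (leftSide m n : Set (Site 2)), ∃ y₁ ∈ (rightSide m n : Set (Site 2)),
        ∃ x₂ ∈ (leftSide m n : Set (Site 2)), ∃ y₂ ∈ (rightSide m n : Set (Site 2)),
          ω ∈ openConnIn (rectangle m n : Set (Site 2)) x₁ y₁ ∧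
          ω ∈ openConnIn (rectangle m n : Set (Site 2)) x₂ y₂ ∧
          ω ∉ openConnIn (rectangle m n : Set (Site 2)) x₁ x₂} ↔ Y ≠ X) := by
  intro m n ω F hω hFE hF0 hFV X Y hX hXs hY hYs
  have hmono : ∀ {u v : Site 2}, ω ∈ openConnIn (rectangle m n : Set (Site 2)) u v →
      ω ∪ F ∈ openConnIn (rectangle m n : Set (Site 2)) u v :=
    fun h => isUpperSet_openConnIn _ _ _ Set.subset_union_left h
  have hright : ∀ a : Finset.Icc (0 : ℤ) n, (![(m : ℤ), (a : ℤ)] : Site 2) ∈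
      (rightSide m n : Set (Site 2)) := by
    intro a
    have := Finset.mem_Icc.1 a.2
    simp only [Finset.mem_coe, rightSide, Finset.mem_filter, mem_rectangle_iff, Matrix.cons_val_zero,
      Matrix.cons_val_one, Matrix.cons_val_fin_one, and_true, le_refl, true_and]
    omega
  constructor
  · rintro ⟨x₁, hx₁, y₁, hy₁, x₂, hx₂, y₂, hy₂, h₁, h₂, h₁₂⟩ hYX
    have hpt : ∀ y : Site 2, y ∈ (rightSide m n : Set (Site 2)) →
        ∃ b : Finset.Icc (0 : ℤ) n, y = ![(m : ℤ), (b : ℤ)] := by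
      intro y hy
      simp only [Finset.mem_coe, rightSide, Finset.mem_filter, mem_rectangle_iff] at hy
      refine ⟨⟨y 1, Finset.mem_Icc.2 ⟨hy.1.2.2.1, hy.1.2.2.2⟩⟩, ?_⟩
      rw [Site.eq_iff_two]
      simp [hy.2]
    obtain ⟨b₁, rfl⟩ := hpt y₁ hy₁
    obtain ⟨b₂, rfl⟩ := hpt y₂ hy₂
    have hYb : Y.1.rel (Sum.inl b₁) (Sum.inl b₂) := by
      refine (hY b₁ b₂).2 ?_
      refine PlanarDuality.openConnIn_trans ?_ (PlanarDuality.openConnIn_trans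
        (d3_leftSide_conn m n ω F hFV x₁ x₂ hx₁ hx₂) (hmono h₂))
      rw [openConnIn_comm]
      exact hmono h₁
    have hXb : ¬ X.1.rel (Sum.inl b₁) (Sum.inl b₂) := by
      intro h
      refine h₁₂ (PlanarDuality.openConnIn_trans h₁ (PlanarDuality.openConnIn_trans ((hX b₁ b₂).1 h) ?_))
      rw [openConnIn_comm]
      exact h₂
    rw [hYX] at hYb
    exact hXb hYb
  · intro hne
    -- the two states differ on a pair of sites, `Y` being the coarser one
    have hex : ∃ a b, Y.1.rel (Sum.inl a) (Sum.inl b) ∧ ¬ X.1.rel (Sum.inl a) (Sum.inl b) := by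
      by_contra hall
      push Not at hall
      apply hne
      apply Subtype.ext
      apply RowState.ext
      apply Setoid.ext
      rintro (a | ⟨⟩) (b | ⟨⟩)
      · exact ⟨hall a b, fun h => (hY a b).2 (hmono ((hX a b).1 h))⟩
      · exact ⟨fun h => absurd h (hYs a), fun h => absurd h (hXs a)⟩
      · exact ⟨fun h => absurd (Y.1.rel.symm' h) (hYs b), fun h => absurd (X.1.rel.symm' h) (hXs b)⟩
      · exact ⟨fun _ => X.1.rel.refl' _, fun _ => Y.1.rel.refl' _⟩
    obtain ⟨a, b, hYab, hXab⟩ := hex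
    rw [hY] at hYab
    rw [hX] at hXab
    rcases d3_union_conn m n ω F hω hFE hF0 _ _ hYab with h | ⟨⟨x₁, hx₁, h₁⟩, ⟨x₂, hx₂, h₂⟩⟩
    · exact absurd h hXab
    · refine ⟨x₁, hx₁, _, hright a, x₂, hx₂, _, hright b, h₁, h₂, fun h₁₂ => hXab ?_⟩
      refine PlanarDuality.openConnIn_trans ?_ (PlanarDuality.openConnIn_trans h₁₂ h₂)
      rw [openConnIn_comm]
      exact h₁

end Summit.CriticalPhenomena.CardyFormulaZ2.Cruxes.StripClusterRates.TwoClusterRateIsStationaryGap
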